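import Literature.Combinatorics.AssociationSchemes.MatchingLevelInequalityWeighted
import Literature.Combinatorics.SetFamily.SpreadApproximationWeighted
import HarnessLib

/-!
# Homogeneous `[0,1]`-WEIGHTS on perfect matchings pull back to biglobal functions, and the matching-side
# level-`k` inequality for them (modulo Keevash–Lifshitz 2023, Theorem 3.1)

Cell pnp-psdrank (summit PneNP, rung F-N2, route `ChebyshevTracialDesign`, crux stmt-PneNP-19878). The weighted
spectral non-tightness input «(SNT-q)_w» of the `r = 2` dense cell (kernel bricks 61–63,
`…ChebyshevTracialDesignDimTwoDenseCellHomogeneous`: a `[0,1]`-valued matching weight `z` that is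
`(PM_n, τ)`-homogeneous AS A WEIGHT — Kupavskii–Zakharov homogeneity of the measure `z`, tree
`SpreadApproximationWeighted.IsRelHomogeneousW`) asks for the matching-side level-`k` inequality «(F2)» for such a
weight. The tree had (F2) for homogeneous SETS (`MatchingLevelInequality.closedSum_sq_le_of_homogeneous`, modulo
Keevash–Lifshitz Thm 1.8) and for products `y · 1_Y` of a bounded weight with a homogeneous SET `Y`
(`MatchingLevelInequalityWeighted`, modulo Thm 3.1: `y1_Ỹ` is biglobal with the parameters of the SET). A
homogeneous weight is neither: its support need not be homogeneous, and the density that must enter the bound is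
the MASS `ν = (Σ_M z(M))/|PM_n|`, not the size of the support. This module closes that gap, along the paper's own
remark after Def. 1.4 (p. 11: for `f = 1_A`, `γ_i = ‖f‖_i = μ(A)^{1/i}`, so `log(γ₂/γ₁) = ½ log(1/μ(A))`), which
holds verbatim for every `[0,1]`-valued `f` with `γ₁ = 𝔼 f`, `γ₂ = √(𝔼 f)` because `f² ≤ f`:

* §1 (`S_n`, namespace `KeevashLifshitz`) **`isBiglobal_sqrt_of_sum_le`**: for `0 ≤ f ≤ 1`, the single family of
  `L¹` conditions `Σ_{σ ∈ U} f σ ≤ r^t γ |U|` on `t`-umvirates `U` (`t ≤ d`, `r ≥ 1`) makes `f`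
  `(r, γ, √γ, d)`-biglobal (Def. 1.4) — the `L²` condition is free; and the consumer form
  **`GlobalLevelDInequalityBiglobal.dual_sqrt`** of Theorem 3.1 for such functions:
  `(Σ_σ f σ g σ)² ≤ ‖g‖² · n! · γ² (2·10⁶ ρ² d⁻¹ log(1/γ))^d` for `(ρ, γ, √γ, d)`-biglobal `f` (`ρ ≥ 1`, `γ > 0`),
  `1 ≤ d ≤ min(⅛ log(1/γ), 10⁻⁵ n)` and `g ∈ V_{≤ d} ⊖ V_{≤ d−1}` (parameter `2ρ > 1`; `log(√γ/γ) = ½ log(1/γ)`);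
* §2 (perfect matchings, namespace `MatchingLevelInequality`) the weighted twins of §8 of `MatchingLevelInequality`
  for a family `ℱ ⊆ PM_n` of edge sets and a weight `z : edge sets → [0,1]` with `IsRelHomogeneousW τ PM_n z ℱ`:
  star densities `wsum_filter_image_permOf_le` / `wsum_inter_pinStar_le` (`(Σ_{ℱ ∩ ⟨F⟩} z)·|PM_n| ≤ τ^{|F|}(Σ_ℱ z)|⟨F⟩|`),
  pin-set densities of the pull-back `wsum_pullback_pinSet_le_closed` / `wsum_pullback_pinSet_le`
  (`(Σ_{σ ∈ U_{P→g}, σsσ⁻¹ ∈ ℱ} z(σsσ⁻¹))·|PM_n| ≤ τ^{|P|}(Σ_ℱ z)|U_{P→g}|`), and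
  **`isBiglobal_pullback_weight`**: the pull-back `σ ↦ z(σ s σ⁻¹)·1[σ s σ⁻¹ ∈ ℱ]` is `(τ, ν, √ν, d)`-biglobal for
  EVERY `d`, `ν = (Σ_{M ∈ ℱ} z M)/|PM_n|` — the one-line answer to «is Thm 3.1's `IsBiglobal` satisfied by
  `(PM, τ)`-homogeneous `[0,1]`-weights of density `ν`?»: YES, with the parameters of the set case
  (`isGlobal_pullback` + `isBiglobal_indicator_mul` give `(τ, ν, √ν, d)` for a `τ`-homogeneous SET of density `ν`);
* §3 **(F2) for homogeneous weights**: `closedSum_sq_le_of_relHomogeneousW` (Kupavskii–Zakharov / edge-set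
  currency) and **`pmatch_closedSum_sq_le_homogeneousW`** (the kernel's `PMatch n` currency, hypothesis literally the
  `IsRelHomogeneousW τ (perfectMatchings univ) (fun M => if hM : IsPMOn univ M then z ⟨M, hM⟩ else 0) (Y.image val)`
  of brick 63): for `0 ≤ z ≤ 1`, `τ ≥ 1`, `ν = (Σ_{M ∈ Y} z M)/|PM_n|`, `p` harmonic of degree `k`,
  `1 ≤ k ≤ min(⅛ log(1/ν), 10⁻⁵ n)`:
  `(Σ_{M ∈ Y} z(M) Π_p(M))² ≤ ν² (C τ² k⁻¹ log(1/ν))^k · |PM_n| · Σ_{M ∈ PM_n} Π_p(M)²`, `C = 2·10⁶` — the SAME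
  shape and constant as the set version, with the mass of `z` in place of `|Y|`.

All modulo the named fact `GlobalLevelDInequalityBiglobal` (hypothesis `h`), exactly as the set versions are modulo
`GlobalLevelDInequality`. Everything here is proved; no new named fact (D-0026). presearch: weighted/measure
homogeneity is Kupavskii–Zakharov's notion applied to a measure [cite: KupavskiiZakharov2022, §2]; biglobal
functions and the `γ_i = ‖f‖_i` remark are [cite: KeevashLifshitz2023, Def. 1.4]; no source treats level
inequalities for weighted families of perfect matchings (LIT-14 §5, LIT-20 §3). WHAT THIS IS NOT: not a proof of
Theorem 3.1; not (SNT-q)_w itself (that is the head estimate of the kernel, bricks 27–29/46, re-run with this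
input); nothing about psd rank; no P-vs-NP content.
-/

noncomputable section

open Finset
open scoped InnerProductSpace

/-! ## §1 `[0,1]`-valued functions: biglobalness is the `L¹` condition -/

namespace Literature.Combinatorics.Additive.KeevashLifshitz

variable {n : ℕ}

/-- **For `0 ≤ f ≤ 1`, `(r, γ, √γ, d)`-biglobalness is the `L¹` condition alone.** If `r ≥ 1`, `γ ≥ 0` and
`Σ_{σ ∈ U_{I→J}} f σ ≤ r^t γ |U_{I→J}|` for all `t`-umvirates with `t ≤ d`, then `f` is `(r, γ, √γ, d)`-biglobal
(Def. 1.4): `‖f_U‖₂² = 𝔼_U f² ≤ 𝔼_U f ≤ r^t γ ≤ (r^t √γ)²`. This is the paper's remark «for `f = 1_A`,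
`γ_i = ‖f‖_i = μ(A)^{1/i}`» for general `[0,1]`-valued `f`.
[cite: KeevashLifshitz2023, Def. 1.4 (p. 11, and the remark following Thm 1.6 there)] -/
theorem isBiglobal_sqrt_of_sum_le {r γ : ℝ} (hr : 1 ≤ r) (hγ : 0 ≤ γ) {d : ℕ} {f : Equiv.Perm (Fin n) → ℝ}
    (hf0 : ∀ σ, 0 ≤ f σ) (hf1 : ∀ σ, f σ ≤ 1)
    (h : ∀ t : ℕ, t ≤ d → ∀ I J : Fin t → Fin n, Function.Injective I → Function.Injective J →
      (∑ σ ∈ umvirate I J, f σ) ≤ r ^ t * γ * ((umvirate I J).card : ℝ)) :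
    IsBiglobal r γ (Real.sqrt γ) d f := by
  intro t ht I J hI hJ
  have h1 := h t ht I J hI hJ
  have habs : (∑ σ ∈ umvirate I J, |f σ|) = ∑ σ ∈ umvirate I J, f σ :=
    sum_congr rfl fun σ _ => abs_of_nonneg (hf0 σ)
  refine ⟨by rw [habs]; exact h1, ?_⟩
  have hsq : (∑ σ ∈ umvirate I J, f σ ^ 2) ≤ ∑ σ ∈ umvirate I J, f σ :=
    sum_le_sum fun σ _ => by nlinarith [hf0 σ, hf1 σ]
  have hrt : (1 : ℝ) ≤ r ^ t := one_le_pow₀ hr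
  have hU : (0 : ℝ) ≤ ((umvirate I J).card : ℝ) := by positivity
  calc (∑ σ ∈ umvirate I J, f σ ^ 2) ≤ r ^ t * γ * ((umvirate I J).card : ℝ) := hsq.trans h1
    _ ≤ (r ^ t * Real.sqrt γ) ^ 2 * ((umvirate I J).card : ℝ) := by
        rw [mul_pow, Real.sq_sqrt hγ]
        refine mul_le_mul_of_nonneg_right (mul_le_mul_of_nonneg_right ?_ hγ) hU
        calc r ^ t = r ^ t * 1 := (mul_one _).symm
          _ ≤ r ^ t * r ^ t := mul_le_mul_of_nonneg_left hrt (by positivity)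
          _ = (r ^ t) ^ 2 := (sq _).symm

/-- **Consumer form of Theorem 3.1 for `(ρ, γ, √γ, d)`-biglobal functions** (`ρ ≥ 1`, `γ > 0` — the shape of
every `[0,1]`-valued function with `γ = 𝔼 f` and the density condition, `isBiglobal_sqrt_of_sum_le`): for
`1 ≤ d ≤ min(⅛ log(1/γ), 10⁻⁵ n)` and every `g ∈ V_{≤ d}` orthogonal to `V_{≤ d−1}`,
`(Σ_σ f σ · g σ)² ≤ ‖g‖² · n! · γ² · (2·10⁶ ρ² d⁻¹ log(1/γ))^d`. (Theorem 3.1 with parameter `2ρ > 1`,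
`γ₁ = γ < γ₂ = √γ` since `γ < 1` is forced by `1 ≤ d ≤ ⅛ log(1/γ)`, and `log(γ₂/γ₁) = ½ log(1/γ)`; the constant
`10⁶ (2ρ)² · ½ = 2·10⁶ ρ²` is the one of the set version `GlobalLevelDInequality_of_biglobal`.)
[cite: KeevashLifshitz2023, Thm. 3.1] -/
theorem GlobalLevelDInequalityBiglobal.dual_sqrt (h : GlobalLevelDInequalityBiglobal) :
    ∀ (n : ℕ) (f : Equiv.Perm (Fin n) → ℝ) (ρ γ : ℝ) (d : ℕ) (g : SnSpace n),
      1 ≤ d → 1 ≤ ρ → 0 < γ → IsBiglobal ρ γ (Real.sqrt γ) d f →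
      (d : ℝ) ≤ Real.log (1 / γ) / 8 → (d : ℝ) ≤ (n : ℝ) / 10 ^ 5 →
      g ∈ degLE n d → (∀ w ∈ degLE n (d - 1), ⟪g, w⟫_ℝ = 0) →
      (∑ σ, f σ * g σ) ^ 2 ≤
        ‖g‖ ^ 2 * n.factorial * (γ ^ 2 * (2 * 10 ^ 6 * ρ ^ 2 * (1 / (d : ℝ)) * Real.log (1 / γ)) ^ d) := by
  intro n f ρ γ d g hd hρ hγ hf h8 hn hg hg'
  -- `γ < 1` is forced by `1 ≤ d ≤ ⅛ log(1/γ)`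
  have hγ1 : γ < 1 := by
    by_contra hge
    have hge' : 1 ≤ γ := not_lt.1 hge
    have hle : Real.log (1 / γ) ≤ 0 :=
      Real.log_nonpos (by positivity) (by rw [div_le_one hγ]; exact hge')
    have : (1 : ℝ) ≤ d := by exact_mod_cast hd
    linarith
  have hsqrt : γ < Real.sqrt γ := by
    have h := Real.sqrt_lt_sqrt hγ.le hγ1
    have hγs : γ = Real.sqrt γ * Real.sqrt γ := (Real.mul_self_sqrt hγ.le).symm
    rw [Real.sqrt_one] at h
    nlinarith [Real.sqrt_nonneg γ]
  -- `log(√γ/γ) = ½ log(1/γ)`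
  have hlog : Real.log (Real.sqrt γ / γ) = Real.log (1 / γ) / 2 := by
    rw [Real.log_div (Real.sqrt_pos.2 hγ).ne' hγ.ne', Real.log_sqrt hγ.le, one_div, Real.log_inv]
    ring
  have h4 : (d : ℝ) ≤ Real.log (Real.sqrt γ / γ) / 4 := by rw [hlog]; linarith
  have hbig : IsBiglobal (2 * ρ) γ (Real.sqrt γ) d f :=
    hf.mono (by linarith) (by linarith) hγ.le (Real.sqrt_nonneg _) le_rfl
  have key := h.dual n f (2 * ρ) γ (Real.sqrt γ) d g hd (by linarith) hγ hsqrt hbig h4 hn hg hg'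
  rw [hlog] at key
  have : 10 ^ 6 * (2 * ρ) ^ 2 * (1 / (d : ℝ)) * (Real.log (1 / γ) / 2) =
      2 * 10 ^ 6 * ρ ^ 2 * (1 / (d : ℝ)) * Real.log (1 / γ) := by ring
  rwa [this] at key

end Literature.Combinatorics.Additive.KeevashLifshitz

/-! ## §2 Homogeneous weights on perfect matchings pull back to biglobal functions -/

namespace Literature.Combinatorics.AssociationSchemes.MatchingLevelInequality

open Equiv
open Literature.Barriers.PneNP
open Literature.Combinatorics.SetFamily
open Literature.Combinatorics.AssociationSchemes.JohnsonHarmonics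
open Literature.Combinatorics.AssociationSchemes.HomogeneousMatchingFamilies
open Literature.Combinatorics.Additive.KeevashLifshitz

variable {n : ℕ}

/-- **Weighted star density, partner form** (the weighted twin of
`HomogeneousMatchingFamilies.isHomogeneousMatchingFamily_image_permOf`). If the weight `z` is
`(perfectMatchings univ, τ)`-homogeneous on the family `ℱ` of perfect matchings (Kupavskii–Zakharov, for the
measure `z`: `z(ℱ(S))·|𝒜| ≤ τ^{|S|} |𝒜(S)| z(ℱ)`), then for every partial matching in partner form `(D, φ)`:
`(Σ_{π ∈ ℱ.image permOf, π|_D = φ} z(edges π)) · |PM_n| ≤ τ^{|D|/2} · (Σ_{M ∈ ℱ} z M) · |{π ∈ PM_n : π|_D = φ}|`.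
[cite: KupavskiiZakharov2022, §2 (definition of (𝒜, τ)-homogeneous)] -/
theorem wsum_filter_image_permOf_le {τ : ℝ} {ℱ : Finset (Finset (Sym2 (Fin n)))}
    (hℱ : ℱ ⊆ perfectMatchings univ) {z : Finset (Sym2 (Fin n)) → ℝ}
    (h : IsRelHomogeneousW τ (perfectMatchings (univ : Finset (Fin n))) z ℱ)
    (D : Finset (Fin n)) (φ : Fin n → Fin n) (hD1 : ∀ x ∈ D, φ x ∈ D) (hD2 : ∀ x ∈ D, φ (φ x) = x)
    (hD3 : ∀ x ∈ D, φ x ≠ x) :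
    (∑ π ∈ (ℱ.image permOf).filter (fun π : Perm (Fin n) => ∀ x ∈ D, π x = φ x), z (edgesOf π)) *
        ((fpfInvolutions n).card : ℝ) ≤
      τ ^ (D.card / 2) * (∑ M ∈ ℱ, z M) *
        (((fpfInvolutions n).filter (fun π : Perm (Fin n) => ∀ x ∈ D, π x = φ x)).card : ℝ) := by
  have hS := h (pmEdges D φ)
  simp only [wmass_def] at hS
  rw [card_perfectMatchings_eq] at hS
  rw [filter_image_permOf_eq hℱ, sum_image_permOf ((supersets_subset ℱ _).trans hℱ),
    card_filter_fpfInvolutions, ← two_mul_card_pmEdges hD1 hD2 hD3,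
    Nat.mul_div_cancel_left _ (by norm_num : 0 < 2)]
  have hsum : ∑ M ∈ supersets ℱ (pmEdges D φ), z (edgesOf (permOf M)) =
      ∑ M ∈ supersets ℱ (pmEdges D φ), z M := by
    refine sum_congr rfl fun M hM => ?_
    rw [edgesOf_permOf (mem_perfectMatchings.1 (hℱ (supersets_subset ℱ _ hM)))]
  rw [hsum]
  calc (∑ M ∈ supersets ℱ (pmEdges D φ), z M) * ((fpfInvolutions n).card : ℝ)
      ≤ τ ^ (pmEdges D φ).card * ((supersets (perfectMatchings univ) (pmEdges D φ)).card : ℝ) *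
          ∑ M ∈ ℱ, z M := hS
    _ = τ ^ (pmEdges D φ).card * (∑ M ∈ ℱ, z M) *
          ((supersets (perfectMatchings univ) (pmEdges D φ)).card : ℝ) := by ring

/-- **Weighted star density on the star of an `s`-closed pin set** (the weighted twin of
`card_inter_pinStar_le`): `(Σ_{π ∈ ℱ.image permOf ∩ star} z(edges π)) · |PM_n| ≤ τ^{|P|/2} (Σ_ℱ z) |star|`.
[cite: KupavskiiZakharov2022, §2] -/
theorem wsum_inter_pinStar_le {τ : ℝ} {ℱ : Finset (Finset (Sym2 (Fin n)))} (hℱ : ℱ ⊆ perfectMatchings univ)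
    {z : Finset (Sym2 (Fin n)) → ℝ} (h : IsRelHomogeneousW τ (perfectMatchings (univ : Finset (Fin n))) z ℱ)
    {s : Perm (Fin n)} (hs : s ∈ fpfInvolutions n) {P : Finset (Fin n)}
    (hP : ∀ x ∈ P, s x ∈ P) {g : Fin n → Fin n} (hg : Set.InjOn g P) :
    (∑ π ∈ ℱ.image permOf ∩ pinStar s P g, z (edgesOf π)) * ((fpfInvolutions n).card : ℝ) ≤
      τ ^ (P.card / 2) * (∑ M ∈ ℱ, z M) * ((pinStar s P g).card : ℝ) := by
  classical
  obtain ⟨hs1, hs2⟩ := mem_fpfInvolutions.1 hs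
  have hss : ∀ x, s (s x) = x := fun x => by
    have := congrArg (fun τ : Perm (Fin n) => τ x) hs1; simpa [Perm.mul_apply] using this
  -- the forced partial matching on `D = g(P)` (as in `card_inter_pinStar_le`)
  set D : Finset (Fin n) := P.image g with hD
  let φ : Fin n → Fin n := fun y => if h : ∃ x ∈ P, g x = y then g (s h.choose) else y
  have hφ : ∀ x ∈ P, φ (g x) = g (s x) := by
    intro x hx
    have h : ∃ x' ∈ P, g x' = g x := ⟨x, hx, rfl⟩
    simp only [φ, dif_pos h]
    have hx' : h.choose = x := hg h.choose_spec.1 hx h.choose_spec.2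
    rw [hx']
  have hD1 : ∀ y ∈ D, φ y ∈ D := by
    intro y hy; obtain ⟨x, hx, rfl⟩ := mem_image.1 hy
    rw [hφ x hx]; exact mem_image_of_mem _ (hP x hx)
  have hD2 : ∀ y ∈ D, φ (φ y) = y := by
    intro y hy; obtain ⟨x, hx, rfl⟩ := mem_image.1 hy
    rw [hφ x hx, hφ (s x) (hP x hx), hss]
  have hD3 : ∀ y ∈ D, φ y ≠ y := by
    intro y hy; obtain ⟨x, hx, rfl⟩ := mem_image.1 hy
    rw [hφ x hx]
    intro h
    exact hs2 x (hg (hP x hx) hx h)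
  have hstar : ∀ π : Perm (Fin n), (∀ y ∈ D, π y = φ y) ↔ (∀ x ∈ P, π (g x) = g (s x)) := by
    intro π; constructor
    · intro h x hx; rw [h (g x) (mem_image_of_mem _ hx), hφ x hx]
    · intro h y hy; obtain ⟨x, hx, rfl⟩ := mem_image.1 hy; rw [h x hx, hφ x hx]
  have hcardD : D.card = P.card := card_image_of_injOn hg
  have hmain := wsum_filter_image_permOf_le hℱ h D φ hD1 hD2 hD3
  have e1 : (ℱ.image permOf).filter (fun π : Perm (Fin n) => ∀ y ∈ D, π y = φ y) =
      ℱ.image permOf ∩ pinStar s P g := by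
    ext π
    simp only [mem_filter, mem_inter, pinStar, hstar]
    constructor
    · intro h; exact ⟨h.1, image_permOf_subset hℱ h.1, h.2⟩
    · intro h; exact ⟨h.1, h.2.2⟩
  have e2 : (fpfInvolutions n).filter (fun π : Perm (Fin n) => ∀ y ∈ D, π y = φ y) = pinStar s P g := by
    ext π
    simp only [mem_filter, pinStar, hstar]
  rw [e1, e2, hcardD] at hmain
  exact hmain

/-- **Weighted density of the pull-back on an `s`-closed pin set** (the weighted twin of
`card_pullback_inter_pinSet_le_closed`):
`(Σ_{σ ∈ U_{P→g}, σsσ⁻¹ ∈ ℱ} z(σsσ⁻¹)) · |PM_n| ≤ τ^{|P|/2} (Σ_ℱ z) |U_{P→g}|`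
(push forward along `σ ↦ σ s σ⁻¹`: all fibres over the star have size `|C(s) ∩ Fix(P)|`, `sum_pinSet_conj`).
[cite: KeevashLifshitz2023, Def. 1.4] -/
theorem wsum_pullback_pinSet_le_closed {τ : ℝ} {ℱ : Finset (Finset (Sym2 (Fin n)))}
    (hℱ : ℱ ⊆ perfectMatchings univ) {z : Finset (Sym2 (Fin n)) → ℝ}
    (h : IsRelHomogeneousW τ (perfectMatchings (univ : Finset (Fin n))) z ℱ)
    {s : Perm (Fin n)} (hs : s ∈ fpfInvolutions n) {P : Finset (Fin n)} (hP : ∀ x ∈ P, s x ∈ P)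
    {g : Fin n → Fin n} (hg : Set.InjOn g P) :
    (∑ σ ∈ (pinSet P g).filter (fun σ : Perm (Fin n) => σ * s * σ⁻¹ ∈ ℱ.image permOf),
        z (edgesOf (σ * s * σ⁻¹))) * ((fpfInvolutions n).card : ℝ) ≤
      τ ^ (P.card / 2) * (∑ M ∈ ℱ, z M) * ((pinSet P g).card : ℝ) := by
  have hconj : (∑ σ ∈ (pinSet P g).filter (fun σ : Perm (Fin n) => σ * s * σ⁻¹ ∈ ℱ.image permOf),
      z (edgesOf (σ * s * σ⁻¹))) =
      ((pinCentraliser s P).card : ℝ) * ∑ π ∈ ℱ.image permOf ∩ pinStar s P g, z (edgesOf π) :=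
    sum_pinSet_conj hs hP hg (ℱ.image permOf) (fun π => z (edgesOf π))
  rw [hconj, card_pinSet_eq hs hP hg]
  have hK : (0 : ℝ) ≤ ((pinCentraliser s P).card : ℝ) := by positivity
  have hst := wsum_inter_pinStar_le hℱ h hs hP hg
  calc ((pinCentraliser s P).card : ℝ) * (∑ π ∈ ℱ.image permOf ∩ pinStar s P g, z (edgesOf π)) *
        ((fpfInvolutions n).card : ℝ)
      = ((pinCentraliser s P).card : ℝ) *
          ((∑ π ∈ ℱ.image permOf ∩ pinStar s P g, z (edgesOf π)) * ((fpfInvolutions n).card : ℝ)) := by ring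
    _ ≤ ((pinCentraliser s P).card : ℝ) * (τ ^ (P.card / 2) * (∑ M ∈ ℱ, z M) * ((pinStar s P g).card : ℝ)) :=
        mul_le_mul_of_nonneg_left hst hK
    _ = τ ^ (P.card / 2) * (∑ M ∈ ℱ, z M) *
          (((pinCentraliser s P).card : ℝ) * ((pinStar s P g).card : ℝ)) := by ring

/-- **Weighted density of the pull-back on an arbitrary pin set** (`τ ≥ 1`, `z ≥ 0`; the weighted twin of
`card_pullback_inter_pinSet_le`): refining `U_{P→g}` by the values on the `s`-closure `P ∪ s(P)` (at most `|P|`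
forced edges) gives `(Σ_{σ ∈ U_{P→g}, σsσ⁻¹ ∈ ℱ} z(σsσ⁻¹)) · |PM_n| ≤ τ^{|P|} (Σ_ℱ z) |U_{P→g}|`.
[cite: KeevashLifshitz2023, Def. 1.4] -/
theorem wsum_pullback_pinSet_le {τ : ℝ} (hτ : 1 ≤ τ) {ℱ : Finset (Finset (Sym2 (Fin n)))}
    (hℱ : ℱ ⊆ perfectMatchings univ) {z : Finset (Sym2 (Fin n)) → ℝ} (hz : ∀ M, 0 ≤ z M)
    (h : IsRelHomogeneousW τ (perfectMatchings (univ : Finset (Fin n))) z ℱ)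
    {s : Perm (Fin n)} (hs : s ∈ fpfInvolutions n) (P : Finset (Fin n)) (g : Fin n → Fin n) :
    (∑ σ ∈ (pinSet P g).filter (fun σ : Perm (Fin n) => σ * s * σ⁻¹ ∈ ℱ.image permOf),
        z (edgesOf (σ * s * σ⁻¹))) * ((fpfInvolutions n).card : ℝ) ≤
      τ ^ P.card * (∑ M ∈ ℱ, z M) * ((pinSet P g).card : ℝ) := by
  classical
  obtain ⟨hs1, hs2⟩ := mem_fpfInvolutions.1 hs
  have hss : ∀ x, s (s x) = x := fun x => by
    have := congrArg (fun τ : Perm (Fin n) => τ x) hs1; simpa [Perm.mul_apply] using this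
  set P' : Finset (Fin n) := P ∪ P.image s with hP'
  have hP'cl : ∀ x ∈ P', s x ∈ P' := by
    intro x hx
    rcases mem_union.1 hx with h | h
    · exact mem_union.2 (Or.inr (mem_image_of_mem _ h))
    · obtain ⟨y, hy, rfl⟩ := mem_image.1 h
      rw [hss]; exact mem_union.2 (Or.inl hy)
  have hPP' : P ⊆ P' := subset_union_left
  have hcardP' : P'.card / 2 ≤ P.card := by
    have : P'.card ≤ P.card + P.card :=
      (card_union_le P (P.image ⇑s)).trans (Nat.add_le_add_left card_image_le _)
    omega
  -- the key of a permutation: its values on `P'`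
  let key : Perm (Fin n) → (Fin n → Fin n) := fun σ x => if x ∈ P' then σ x else x
  have hfibre : ∀ σ₀ ∈ pinSet P g,
      (pinSet P g).filter (fun σ : Perm (Fin n) => key σ = key σ₀) = pinSet P' (key σ₀) := by
    intro σ₀ hσ₀
    rw [mem_pinSet] at hσ₀
    ext σ
    simp only [mem_filter, mem_pinSet]
    constructor
    · rintro ⟨-, hk⟩ x hx
      have := congrFun hk x
      simp only [key, if_pos hx] at this
      simp only [key, if_pos hx]
      exact this
    · intro h
      have hk : key σ = key σ₀ := by
        funext x
        by_cases hx : x ∈ P'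
        · have := h x hx; simp only [key, if_pos hx] at this ⊢; exact this
        · simp only [key, if_neg hx]
      refine ⟨fun x hx => ?_, hk⟩
      have := h x (hPP' hx)
      simp only [key, if_pos (hPP' hx)] at this
      rw [this, hσ₀ x hx]
  have hinj : ∀ σ₀ : Perm (Fin n), Set.InjOn (key σ₀) P' := by
    intro σ₀ x hx y hy hxy
    simp only [key, if_pos (mem_coe.1 hx), if_pos (mem_coe.1 hy)] at hxy
    exact σ₀.injective hxy
  -- sum over the classes
  have hZ : 0 ≤ ∑ M ∈ ℱ, z M := sum_nonneg fun M _ => hz M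
  set T := (pinSet P g).image key with hT
  have hL : (∑ σ ∈ (pinSet P g).filter (fun σ : Perm (Fin n) => σ * s * σ⁻¹ ∈ ℱ.image permOf),
      z (edgesOf (σ * s * σ⁻¹))) =
      ∑ κ ∈ T, ∑ σ ∈ ((pinSet P g).filter (fun σ : Perm (Fin n) => key σ = κ)).filter
        (fun σ : Perm (Fin n) => σ * s * σ⁻¹ ∈ ℱ.image permOf), z (edgesOf (σ * s * σ⁻¹)) := by
    rw [← sum_fiberwise_of_maps_to
      (s := (pinSet P g).filter (fun σ : Perm (Fin n) => σ * s * σ⁻¹ ∈ ℱ.image permOf)) (t := T)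
      (g := key) (fun σ hσ => mem_image_of_mem _ (mem_filter.1 hσ).1)]
    refine sum_congr rfl fun κ _ => sum_congr ?_ fun _ _ => rfl
    ext σ
    simp only [mem_filter]
    tauto
  have hR : ((pinSet P g).card : ℝ) =
      ∑ κ ∈ T, (((pinSet P g).filter (fun σ : Perm (Fin n) => key σ = κ)).card : ℝ) := by
    rw [← Nat.cast_sum, card_eq_sum_card_image key (pinSet P g)]
  rw [hL, hR, mul_sum, sum_mul]
  refine sum_le_sum fun κ hκ => ?_
  obtain ⟨σ₀, hσ₀, rfl⟩ := mem_image.1 hκ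
  rw [hfibre σ₀ hσ₀]
  have hcl := wsum_pullback_pinSet_le_closed hℱ h hs hP'cl (hinj σ₀)
  calc (∑ σ ∈ (pinSet P' (key σ₀)).filter (fun σ : Perm (Fin n) => σ * s * σ⁻¹ ∈ ℱ.image permOf),
          z (edgesOf (σ * s * σ⁻¹))) * ((fpfInvolutions n).card : ℝ)
      ≤ τ ^ (P'.card / 2) * (∑ M ∈ ℱ, z M) * ((pinSet P' (key σ₀)).card : ℝ) := hcl
    _ ≤ τ ^ P.card * (∑ M ∈ ℱ, z M) * ((pinSet P' (key σ₀)).card : ℝ) := by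
        have hpow : τ ^ (P'.card / 2) ≤ τ ^ P.card := pow_le_pow_right₀ hτ hcardP'
        exact mul_le_mul_of_nonneg_right (mul_le_mul_of_nonneg_right hpow hZ) (by positivity)

/-- **HOMOGENEOUS `[0,1]`-WEIGHTS PULL BACK TO BIGLOBAL FUNCTIONS** (the weighted twin of `isGlobal_pullback` +
`isBiglobal_indicator_mul`). Let `ℱ ⊆ PM_n` be a family of perfect matchings (edge sets), `z` a weight with
`0 ≤ z ≤ 1` that is `(perfectMatchings univ, τ)`-homogeneous on `ℱ` (Kupavskii–Zakharov homogeneity of the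
measure `z·1_ℱ`, tree `IsRelHomogeneousW`), `τ ≥ 1`, and `ν = (Σ_{M ∈ ℱ} z M)/|PM_n|` its density. Then for
every reference matching `s` the pull-back `σ ↦ z(σ s σ⁻¹) · 1[σ s σ⁻¹ ∈ ℱ]` on `S_n` is
`(τ, ν, √ν, d)`-biglobal (Def. 1.4) for EVERY `d`: on a `t`-umvirate its mean is `≤ τ^t ν`
(`wsum_pullback_pinSet_le`) and, being `[0,1]`-valued, its second moment is at most its mean
(`isBiglobal_sqrt_of_sum_le`). These are exactly the parameters of the set case (`τ`-homogeneous SET of density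
`ν` ⇒ `√τ`-global ⇒ `(τ, ν, √ν, d)`-biglobal), with the MASS of `z` as the density.
[cite: KeevashLifshitz2023, Def. 1.4 (p. 11 remark: `γ_i = ‖f‖_i`)] -/
theorem isBiglobal_pullback_weight {τ : ℝ} (hτ : 1 ≤ τ) {ℱ : Finset (Finset (Sym2 (Fin n)))}
    (hℱ : ℱ ⊆ perfectMatchings univ) {z : Finset (Sym2 (Fin n)) → ℝ} (hz0 : ∀ M, 0 ≤ z M)
    (hz1 : ∀ M, z M ≤ 1) (h : IsRelHomogeneousW τ (perfectMatchings (univ : Finset (Fin n))) z ℱ)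
    {s : Perm (Fin n)} (hs : s ∈ fpfInvolutions n) (d : ℕ) :
    IsBiglobal τ ((∑ M ∈ ℱ, z M) / ((fpfInvolutions n).card : ℝ))
      (Real.sqrt ((∑ M ∈ ℱ, z M) / ((fpfInvolutions n).card : ℝ))) d
      (fun σ => if σ * s * σ⁻¹ ∈ ℱ.image permOf then z (edgesOf (σ * s * σ⁻¹)) else 0) := by
  classical
  have hN : (0 : ℝ) < ((fpfInvolutions n).card : ℝ) := by exact_mod_cast card_pos.2 ⟨s, hs⟩
  have hZ : 0 ≤ ∑ M ∈ ℱ, z M := sum_nonneg fun M _ => hz0 M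
  refine isBiglobal_sqrt_of_sum_le hτ (div_nonneg hZ hN.le) (fun σ => ?_) (fun σ => ?_) ?_
  · split_ifs
    · exact hz0 _
    · exact le_rfl
  · split_ifs
    · exact hz1 _
    · exact zero_le_one
  intro t _ I J hI hJ
  rw [umvirate_eq_pinSet hI J, ← sum_filter]
  have hd : (univ.image I).card = t := by rw [card_image_of_injective _ hI, card_univ, Fintype.card_fin]
  have key := wsum_pullback_pinSet_le hτ hℱ hz0 h hs (univ.image I) (pinMap I J)
  rw [hd] at key
  have hrew : τ ^ t * ((∑ M ∈ ℱ, z M) / ((fpfInvolutions n).card : ℝ)) *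
      ((pinSet (univ.image I) (pinMap I J)).card : ℝ) =
      τ ^ t * (∑ M ∈ ℱ, z M) * ((pinSet (univ.image I) (pinMap I J)).card : ℝ) /
        ((fpfInvolutions n).card : ℝ) := by ring
  rw [hrew, le_div_iff₀ hN]
  exact key

/-! ## §3 The matching-side level-`k` inequality for homogeneous weights (modulo Keevash–Lifshitz Thm 3.1) -/

/-- **(F2) FOR HOMOGENEOUS `[0,1]`-WEIGHTS, KUPAVSKII–ZAKHAROV CURRENCY (modulo Keevash–Lifshitz Thm 3.1).**
For a family `ℱ` of perfect matchings of `K_n` (edge sets), a weight `z` with `0 ≤ z ≤ 1` that is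
`(perfectMatchings univ, τ)`-homogeneous on `ℱ` (`τ ≥ 1`), `ν = (Σ_{M ∈ ℱ} z M)/|PM_n|`, and a harmonic
coefficient vector `p` of degree `k` with `1 ≤ k ≤ min(⅛ log(1/ν), 10⁻⁵ n)`:
`(Σ_{M ∈ ℱ} z(M) Π_p(M))² ≤ ν² · (C τ² k⁻¹ log(1/ν))^k · |PM_n| · Σ_{M ∈ PM_n} Π_p(M)²`, `C = 2·10⁶`,
`Π_p(M) = closedSum k p (permOf M)` — the shape and constant of the set version
`HomogeneousMatchingFamilies.closedSum_sq_le_of_relHomogeneous`, with the mass of `z` for `|ℱ|`. Proof: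
Theorem 3.1 (consumer form `dual_sqrt`) for the `(τ, ν, √ν, k)`-biglobal pull-back (`isBiglobal_pullback_weight`)
against the pure degree-`k` vector `G_p`; the fibres of `σ ↦ σ s σ⁻¹` have the constant size `|C(s)|`, which
cancels. [cite: KeevashLifshitz2023, Thm. 3.1] -/
theorem closedSum_sq_le_of_relHomogeneousW (h : GlobalLevelDInequalityBiglobal) :
    ∃ C : ℝ, 0 < C ∧ ∀ (n : ℕ) (ℱ : Finset (Finset (Sym2 (Fin n)))),
      ℱ ⊆ perfectMatchings (univ : Finset (Fin n)) →
      ∀ (z : Finset (Sym2 (Fin n)) → ℝ), (∀ M, 0 ≤ z M) → (∀ M, z M ≤ 1) →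
      ∀ (τ : ℝ) (k : ℕ) (p : Finset (Fin n) → ℝ), 1 ≤ τ →
      IsRelHomogeneousW τ (perfectMatchings (univ : Finset (Fin n))) z ℱ →
      1 ≤ k → IsHarmonic k p →
      (k : ℝ) ≤ Real.log (1 / ((∑ M ∈ ℱ, z M) / (perfectMatchings (univ : Finset (Fin n))).card)) / 8 →
      (k : ℝ) ≤ (n : ℝ) / 10 ^ 5 →
      (∑ M ∈ ℱ, z M * closedSum k p (permOf M)) ^ 2 ≤
        ((∑ M ∈ ℱ, z M) / (perfectMatchings (univ : Finset (Fin n))).card) ^ 2 *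
          (C * τ ^ 2 * (1 / (k : ℝ)) *
            Real.log (1 / ((∑ M ∈ ℱ, z M) / (perfectMatchings (univ : Finset (Fin n))).card))) ^ k *
          ((perfectMatchings (univ : Finset (Fin n))).card *
            ∑ M ∈ perfectMatchings (univ : Finset (Fin n)), closedSum k p (permOf M) ^ 2) := by
  refine ⟨2 * 10 ^ 6, by norm_num, fun n ℱ hℱ z hz0 hz1 τ k p hτ hhom hk hp h8 hn => ?_⟩
  classical
  rw [card_perfectMatchings_eq] at h8 ⊢
  rw [← sum_fpfInvolutions_eq (fun π => closedSum k p π ^ 2)]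
  -- the mass is positive (otherwise `1 ≤ k ≤ ⅛ log(1/0) = 0`)
  have hZ0 : 0 ≤ ∑ M ∈ ℱ, z M := sum_nonneg fun M _ => hz0 M
  have hZpos : 0 < ∑ M ∈ ℱ, z M := by
    rcases hZ0.lt_or_eq with hlt | heq
    · exact hlt
    · exfalso
      rw [← heq, zero_div, div_zero, Real.log_zero, zero_div] at h8
      have : (1 : ℝ) ≤ k := by exact_mod_cast hk
      linarith
  have hne : ℱ.Nonempty := by
    by_contra hF
    rw [not_nonempty_iff_eq_empty] at hF
    rw [hF, sum_empty] at hZpos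
    exact lt_irrefl _ hZpos
  obtain ⟨M₀, hM₀⟩ := hne
  obtain ⟨s, hs⟩ : ∃ s : Perm (Fin n), s ∈ fpfInvolutions n :=
    ⟨permOf M₀, permOf_mem_fpfInvolutions (mem_perfectMatchings.1 (hℱ hM₀))⟩
  have hN : (0 : ℝ) < ((fpfInvolutions n).card : ℝ) := by exact_mod_cast card_pos.2 ⟨s, hs⟩
  have hν : 0 < (∑ M ∈ ℱ, z M) / ((fpfInvolutions n).card : ℝ) := div_pos hZpos hN
  -- Theorem 3.1 for the biglobal pull-back against `G_p`
  have hbig := isBiglobal_pullback_weight hτ hℱ hz0 hz1 hhom hs k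
  have hmain := h.dual_sqrt n _ τ _ k (pullVec s k p) hk hτ hν hbig h8 hn
    (pullVec_mem_degLE s k p) (fun w hw => inner_pullVec_eq_zero_of_mem_degLE (by omega) s hp hw)
  -- evaluate the left side: `|C(s)| · Σ_{M ∈ ℱ} z M Π_p(M)`
  have hY : ℱ.image permOf ⊆ fpfInvolutions n := image_permOf_subset hℱ
  have hsum : (∑ σ, (if σ * s * σ⁻¹ ∈ ℱ.image permOf then z (edgesOf (σ * s * σ⁻¹)) else 0) *
        pullVec s k p σ) =
      ((transporters s s).card : ℝ) * ∑ M ∈ ℱ, z M * closedSum k p (permOf M) := by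
    have h1 : (∑ σ, (if σ * s * σ⁻¹ ∈ ℱ.image permOf then z (edgesOf (σ * s * σ⁻¹)) else 0) *
          pullVec s k p σ) =
        ∑ σ ∈ pullback s (ℱ.image permOf), z (edgesOf (σ * s * σ⁻¹)) * pullVec s k p σ := by
      rw [pullback, sum_filter]
      refine sum_congr rfl fun σ _ => ?_
      split_ifs <;> simp
    have h2 : ∑ σ ∈ pullback s (ℱ.image permOf), z (edgesOf (σ * s * σ⁻¹)) * pullVec s k p σ =
        ((transporters s s).card : ℝ) * ∑ π ∈ ℱ.image permOf, z (edgesOf π) * closedSum k p π :=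
      sum_pullback_weight_pullVec s hs hY (fun π => z (edgesOf π)) k p
    rw [h1, h2, sum_image_permOf hℱ]
    congr 1
    refine sum_congr rfl fun M hM => ?_
    rw [edgesOf_permOf (mem_perfectMatchings.1 (hℱ hM))]
  rw [hsum, norm_pullVec_sq s hs, factorial_eq_card_mul s hs] at hmain
  -- divide by `|C(s)|² > 0`
  set c : ℝ := ((transporters s s).card : ℝ) with hc_def
  have hc : (0 : ℝ) < c := by
    have : (transporters s s).Nonempty := ⟨1, mem_filter.2 ⟨mem_univ _, by simp⟩⟩
    rw [hc_def]; exact_mod_cast card_pos.2 this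
  set A : ℝ := ∑ M ∈ ℱ, z M * closedSum k p (permOf M)
  set B : ℝ := ∑ π ∈ fpfInvolutions n, closedSum k p π ^ 2
  set N : ℝ := ((fpfInvolutions n).card : ℝ)
  set K : ℝ := ((∑ M ∈ ℱ, z M) / N) ^ 2 *
    (2 * 10 ^ 6 * τ ^ 2 * (1 / (k : ℝ)) * Real.log (1 / ((∑ M ∈ ℱ, z M) / N))) ^ k
  have h' : c ^ 2 * A ^ 2 ≤ c ^ 2 * (K * (N * B)) := by
    calc c ^ 2 * A ^ 2 = (c * A) ^ 2 := by ring
      _ ≤ c * B * (c * N) * K := hmain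
      _ = c ^ 2 * (K * (N * B)) := by ring
  exact le_of_mul_le_mul_left h' (by positivity)

/-- **(F2) FOR HOMOGENEOUS `[0,1]`-WEIGHTS IN THE KERNEL'S CURRENCY (modulo Keevash–Lifshitz Thm 3.1).** For
`Y : Finset (PMatch n)`, a weight `z : PMatch n → [0, 1]` whose lift to edge sets is
`(perfectMatchings univ, τ)`-homogeneous on `Y` (`τ ≥ 1`; literally the hypothesis shape of the kernel's weighted
(SNT-q), brick 63, with `Y = univ`), `ν = (Σ_{M ∈ Y} z M)/|PMatch n|`, and a harmonic `p` of degree `k` with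
`1 ≤ k ≤ min(⅛ log(1/ν), 10⁻⁵ n)`, the weighted matching-side sums of the bi-mode expansion satisfy
`(Σ_{M ∈ Y} z(M) Σ_{T : #{x∈T : M.partner x ∈ T} = k} p_T)² ≤ ν²·(C τ² k⁻¹ log(1/ν))^k·|PMatch n|·Σ_{M : PMatch n} (Σ_T …)²`,
`C = 2·10⁶` — the drop-in twin of `HomogeneousMatchingFamilies.pmatch_closedSum_sq_le` (homogeneous SETS) and of
`pmatch_closedSum_sq_le_weighted` (bounded weight × homogeneous SET) for homogeneous WEIGHTS, density = mass.
[cite: KeevashLifshitz2023, Thm. 3.1] -/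
theorem pmatch_closedSum_sq_le_homogeneousW (h : GlobalLevelDInequalityBiglobal) :
    ∃ C : ℝ, 0 < C ∧ ∀ (n : ℕ) (Y : Finset (PMatch n)) (z : PMatch n → ℝ) (τ : ℝ) (k : ℕ)
      (p : Finset (Fin n) → ℝ), (∀ M, 0 ≤ z M) → (∀ M, z M ≤ 1) → 1 ≤ τ →
      IsRelHomogeneousW τ (perfectMatchings (univ : Finset (Fin n)))
        (fun M : Finset (Sym2 (Fin n)) => if hM : IsPMOn (univ : Finset (Fin n)) M then z ⟨M, hM⟩ else 0)
        (Y.image Subtype.val) →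
      1 ≤ k → IsHarmonic k p →
      (k : ℝ) ≤ Real.log (1 / ((∑ M ∈ Y, z M) / Fintype.card (PMatch n))) / 8 →
      (k : ℝ) ≤ (n : ℝ) / 10 ^ 5 →
      (∑ M ∈ Y, z M *
          ∑ T ∈ univ.filter (fun T : Finset (Fin n) => (T.filter fun x => M.2.partner x ∈ T).card = k), p T) ^ 2 ≤
        ((∑ M ∈ Y, z M) / Fintype.card (PMatch n)) ^ 2 *
          (C * τ ^ 2 * (1 / (k : ℝ)) * Real.log (1 / ((∑ M ∈ Y, z M) / Fintype.card (PMatch n)))) ^ k *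
          ((Fintype.card (PMatch n) : ℝ) *
            ∑ M : PMatch n,
              (∑ T ∈ univ.filter (fun T : Finset (Fin n) => (T.filter fun x => M.2.partner x ∈ T).card = k), p T) ^ 2) := by
  obtain ⟨C, hC, hmain⟩ := closedSum_sq_le_of_relHomogeneousW h
  refine ⟨C, hC, fun n Y z τ k p hz0 hz1 hτ hhom hk hp h8 hn => ?_⟩
  classical
  -- rewrite the kernel's functional as `closedSum k p (toPerm M)`
  have hfun : ∀ M : PMatch n,
      ∑ T ∈ univ.filter (fun T : Finset (Fin n) => (T.filter fun x => M.2.partner x ∈ T).card = k), p T =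
        closedSum k p (toPerm M) := by
    intro M
    rw [← closedSum_eq_sum_filter_card hp.1 (toPerm M)]
    refine sum_congr ?_ fun _ _ => rfl
    ext T
    simp only [mem_filter, mem_univ, true_and, toPerm_apply]
  simp_rw [hfun]
  -- the lifted weight and its sums
  set zh : Finset (Sym2 (Fin n)) → ℝ :=
    fun M => if hM : IsPMOn (univ : Finset (Fin n)) M then z ⟨M, hM⟩ else 0 with hzh_def
  have hzh0 : ∀ M, 0 ≤ zh M := by
    intro M; simp only [hzh_def]; split_ifs
    · exact hz0 _
    · exact le_rfl
  have hzh1 : ∀ M, zh M ≤ 1 := by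
    intro M; simp only [hzh_def]; split_ifs
    · exact hz1 _
    · exact zero_le_one
  have hval : ∀ M : PMatch n, zh M.1 = z M := by
    intro M; simp only [hzh_def, dif_pos M.2]
  have hmass : ∑ M ∈ Y.image Subtype.val, zh M = ∑ M ∈ Y, z M := by
    rw [sum_image fun _ _ _ _ h => Subtype.val_injective h]
    exact sum_congr rfl fun M _ => hval M
  have hlhs : ∑ M ∈ Y.image Subtype.val, zh M * closedSum k p (permOf M) =
      ∑ M ∈ Y, z M * closedSum k p (toPerm M) := by
    rw [sum_image fun _ _ _ _ h => Subtype.val_injective h]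
    exact sum_congr rfl fun M _ => by rw [hval M]; rfl
  have hrhs : ∑ M ∈ perfectMatchings (univ : Finset (Fin n)), closedSum k p (permOf M) ^ 2 =
      ∑ M : PMatch n, closedSum k p (toPerm M) ^ 2 := by
    rw [← sum_fpfInvolutions_eq (fun π => closedSum k p π ^ 2), sum_fpfInvolutions_eq_sum_pmatch]
  have hcard : ((perfectMatchings (univ : Finset (Fin n))).card : ℝ) = (Fintype.card (PMatch n) : ℝ) := by
    rw [card_perfectMatchings_eq, card_pmatch_eq]
  have key := hmain n (Y.image Subtype.val) (image_val_subset Y) zh hzh0 hzh1 τ k p hτ hhom hk hp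
  rw [hmass, hlhs, hrhs, hcard] at key
  exact key h8 hn

end Literature.Combinatorics.AssociationSchemes.MatchingLevelInequality
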